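import Summits.QuantumFields.BalabanUV.Beta.DshAn1
import Summits.QuantumFields.BalabanUV.Beta.SymCorrectorForms

/-!
# `BalabanUV.Beta.BondIndicatorGaugeL1` — **«COMB-WEIGHT-BLOCK-L1»: THE ℓ¹-DUAL OF THE TREE-GAUGE BOUND — SUMMED OVER ANY FINITE SET OF BONDS, THE
# (SYMMETRISED) ROOTED TREE GAUGES OF THE BOND INDICATORS ARE BOUNDED BY THE CONTOUR LENGTH; HENCE THE BLOCK-ℓ¹ LAW OF an1's COMB WEIGHTS
# `Σ_κ Σ_{b ∈ box} |lam04 N κ (N•y′ + b) Y| ≤ N^{d+1}·((d+1)·N)` AND OF THE FACE WEIGHTS `|box|⁻¹·lam04`: `≤ (d+1)·N` PER BLOCK — POWER `N¹`**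
# (UNCONDITIONAL; [folklore] finite combinatorics of OUR comb objects `axial`, `treeGaugeAt`, `symTreeGaugeAt`, `SymLamAt`, `lam04`)

HONEST DEPENDENCY (cell records, verbatim): «continuum YM on T⁴ ⇐ BetaPertH ∧ nine spine estimates (0/9 proved); BetaPertH ⇐ (D1) ∧ (D4) ∧
CAP+tail; G-an2-4 gates asym, D1 and NE2/3/4.»  HONEST FRAMING (cell contract, verbatim): «discharging `BetaPertH` makes Bałaban's UV stability
UNCONDITIONAL — a real constructive-QFT result; it is NOT the continuum limit and NOT the Clay problem.»  THIS MODULE DISCHARGES NOTHING of the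
wall: [folklore] finite bookkeeping BY NAME over the cell's comb files — the letterwise transport of the axial contour (`AxialProjector.axial_map`), its
letters (`AxialDressingRooted.mem_axial`) and length (`AveragingContours.axial_length`, `AxialDressingRooted.axial_length_le_of_root`), the axis-order
dictionary (`SymmetrisedAxialPotential.symTreeGaugeAt_eq_sum`, `SymmetrisedDressingMatrix.P1_bondIndR ∕ treeGaugeAt_bondIndR`), an1's block potential of
a bond indicator (`DshAn1.lam04`, `DshAn1.SymLamAt_eq_sum_symTreeGaugeAt`) and leaf-03's letter `SymCorrectorForms.zetaS` (by `rfl`).  Nothing about Bałaban's (or an1's ∕ an3's) TABLES is asserted; no count is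
transcribed; the exact law `Σ_j |lam04 N j| = D·N^{D−1}(N−1)(N+1)∕4` of the OWNER's N-g22-1 is NOT proved (only the bound with constant `D` in place of
`D∕4·(1 + 1∕N)`, which has the same POWER).  No definition, no `def … : Prop`, nothing cited, 0 sorry.  NO (1.22) unit row is proved here.  0 root-level
binders of row D1 discharged (hW ∕ hR-sockets ∕ hSX-socket ∕ D1Tel ∕ D1Rep = 0); (J1) = ONE OPEN ROW `hC₁ := Δ_n`; [W] OPEN; (K) NOT closed; NOT D1, NOT
`BetaPertH`, NOT continuum, NOT Clay.

ABSOLUTE RULE (cell charter, verbatim): «No internally-minted statement may enter as a cited fact. Every hypothesis is either kernel-proved in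
this package or a verbatim quotation of a PUBLISHED theorem with page reference. The manuscript(s) under audit are NOT citable for their own
disputed steps — they are the thing under adjudication; programme-internal (2001/route/tribunal) claims are never citable.»

WHY (road OWNER d1-p2 g22, `J1-DEFECT-WORDS.md` v0.1 §6 W-5 and LOCATED NOTE N-g22-1, journal): the (J1) defect words' contact families carry the face weights
`c_{α,x} = |box|⁻¹·ζ_S(e_{(α,x)})(blk x) = |box|⁻¹·lam04 N α x (blk x)`; they are O(1) each (`max → 1∕(2D)`), so what makes the contact families' (M-b) rows k-free
is their BLOCK-ℓ¹ law — N-g22-1 counts `|box|⁻¹·Σ_{j ∈ B} |lam04 j| ≈ (D∕4)·N` and records «the tree's `DshAn1Spread.abs_lam04_le` (`≤ N^D·D·N`) is weaker than the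
count by `2D²·N`; a sharp `Σ_j |lam04|` lemma is the W-5 row input».  The per-bond bound summed over the `D·N^D` bonds of a block gives `N^{2D}·D·N`; the present
file proves that the SUM over all bonds obeys the SINGLE-bond bound `N^D·D·N` — after `|box|⁻¹`, POWER `N¹` — which is exactly the product letter's first factor in
this lineage's «FACE-PACK» (`D1BFx/PackedColumnBlockIndexedMass.mass_blk_vertexOfK_G₀_le_of_blockIndexed_split`, `hcB` with `cW := d+1`).  The mechanism is the
ℓ¹-DUAL of `abs_treeGaugeAt_bondInd_le`: the axial contour `Γ_{root, x}` has `|x − root|₁ ≤ n·N` letters, each `±A_κ(z)`; for the family of bond indicators the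
letters are `±δ`, so the finset-ℓ¹ seminorm `A ↦ Σ_{b ∈ S} |A(Γ)(b)|` of the contour sum is at most the number of letters — for EVERY finite set `S` of bonds at
once (transport the contour along the evaluation homomorphisms of the universal indicator form, `axial_map`; no injectivity of the comb is used).  The symmetrised
gauge sums `n!` combs in permuted coordinates (re-index `S` per axis order), an1's `SymLamAt` sums the block's `N^{d+1}` targets.

CONTENT (all [folklore]).
* §1 GENERIC comb (`n` directions, any root ∕ target): `sum_abs_apply_list_sum_le` (finset-ℓ¹ of a list sum of lattice functions with letters of finset-ℓ¹ `≤ 1`);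
  **`sum_abs_axial_bondInd_sum_le`**: `Σ_{b ∈ S} |(axial (bondInd b.1 b.2) y x).sum| ≤ Σ_i |x_i − y_i|`; **`sum_abs_treeGaugeAt_bondInd_le`**: `Σ_{b ∈ S} |treeGaugeAt
  (toSite r) (bondInd b.1 b.2) N z| ≤ n·N` (in-block root).
* §2 SYMMETRISED: **`sum_abs_symTreeGaugeAt_bondIndR_le`**: `Σ_{b ∈ S} |symTreeGaugeAt (toSite r) (bondIndR b.1 b.2) N x| ≤ n!·(n·N)` — the single-bond bound of
  `SymmetrisedDressingMatrix.abs_symTreeGaugeAt_bondIndR_le`, now for the sum over `S`.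
* §3 an1's COMB WEIGHTS (`d+1` directions, centred root): **`sum_univ_box_abs_lam04_le`**: `Σ_κ Σ_{b ∈ box (d+1) N} |lam04 N κ (N•y′ + b) Y| ≤ N^{d+1}·((d+1)·N)` (every
  `y′ Y`); `sum_box_abs_lam04_le` (one direction); **`sum_box_abs_faceWeight_le`**: the FACE WEIGHTS `|box|⁻¹·lam04 N κ u (blk u)` have block-ℓ¹ norm
  `Σ_{b ∈ box} |…(N•y′ + b)…| ≤ N·(d+1)` — «FACE-PACK»'s `hcB` with `cW := d+1`; `sum_box_abs_zetaS_delta1_le`: the same in leaf-03's `zetaS` letter (TT3a `faceWt`).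
NOT HERE (honest): the exact `(N+1)∕4` mean law (N-g22-1); the face family (W-3′, leaf-03's TT3); the face totals of the raw tables' masses (the table author);
any (1.22) row; the size of `hC₁`.
Unit `b2b-balaban-gan24-formalise-leaf-05` (gen 58), G-an2-4 swarm leaf prover 05, road «BF-x» supplier; lane claim W-3 ∕ INTENT-2 «COMB-WEIGHT-BLOCK-L1» (journal).
-/

noncomputable section

open Finset
open scoped BigOperators Nat
open Literature.MathematicalPhysics.QuantumFieldTheory
open Literature.MathematicalPhysics.QuantumFieldTheory.Balaban1983to89
open Literature.MathematicalPhysics.QuantumFieldTheory.Balaban1983to89.Beta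
open AffineAveraging (Form1 Site box toSite)
open AveragingContours (blk axial axial_length blk_block)
open AveragingContoursRooted (treeGaugeAt ctr ctrOff ctrOff_mem_box)
open AxialProjector (axial_map)
open KKTFluctuationKernel (delta1)
open Summit.QuantumFields.BalabanUV.Beta.KernelPermutation (psite)
open Summit.QuantumFields.BalabanUV.Beta.ResolventPermutation (P1)
open Summit.QuantumFields.BalabanUV.Beta.AxialDressingRooted (bondInd bondInd_apply mem_axial axial_length_le_of_root)
open Summit.QuantumFields.BalabanUV.Beta.SymmetrisedAxialPotential (symTreeGaugeAt symTreeGaugeAt_eq_sum SymLamAt card_perm_fin)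
open Summit.QuantumFields.BalabanUV.Beta.SymmetrisedDressingMatrix (bondIndR P1_bondIndR treeGaugeAt_bondIndR psite_symm_toSite psite_symm_mem_box)
open Summit.QuantumFields.BalabanUV.Beta.SymGaugeMultiplierBlockMean (bondIndR_eq_delta1)
open Summit.QuantumFields.BalabanUV.Beta.DshAn1 (lam04 SymLamAt_eq_sum_symTreeGaugeAt)
open Summit.QuantumFields.BalabanUV.Beta.SymCorrectorForms (zetaS)

namespace Summit.QuantumFields.BalabanUV.Beta.BondIndicatorGaugeL1

/-! ## §1 Generic comb: the finset-ℓ¹ seminorm of the contour sum of the bond indicators is at most the contour length -/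

section Comb

variable {n : ℕ}

/-- [folklore] **THE FINSET-ℓ¹ SEMINORM OF A LIST SUM**: if every letter `a` of a list of lattice functions has `Σ_{b ∈ S} |a b| ≤ 1`, the list sum has
`Σ_{b ∈ S} |(Σ a) b| ≤ length` (triangle inequality, letter by letter). -/
theorem sum_abs_apply_list_sum_le {B : Type*} (S : Finset B) :
    ∀ (l : List (B → ℤ)), (∀ a ∈ l, ∑ b ∈ S, |a b| ≤ 1) → ∑ b ∈ S, |l.sum b| ≤ (l.length : ℤ)
  | [], _ => by simp
  | a :: t, h => by
    have ha : ∑ b ∈ S, |a b| ≤ 1 := h a (by simp)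
    have ht : ∑ b ∈ S, |t.sum b| ≤ (t.length : ℤ) := sum_abs_apply_list_sum_le S t fun a' ha' => h a' (by simp [ha'])
    simp only [List.sum_cons, List.length_cons, Nat.cast_add, Nat.cast_one, Pi.add_apply]
    calc ∑ b ∈ S, |a b + t.sum b| ≤ ∑ b ∈ S, (|a b| + |t.sum b|) := Finset.sum_le_sum fun b _ => abs_add_le _ _
      _ = ∑ b ∈ S, |a b| + ∑ b ∈ S, |t.sum b| := Finset.sum_add_distrib
      _ ≤ 1 + (t.length : ℤ) := add_le_add ha ht
      _ = (t.length : ℤ) + 1 := add_comm _ _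

/-- [folklore] **THE ℓ¹-DUAL OF THE CONTOUR BOUND**: for EVERY finite set `S` of bonds, the contour sums of the bond indicators along the axial contour `Γ_{y,x}` satisfy
`Σ_{b ∈ S} |δ_b(Γ_{y,x})| ≤ |x − y|₁ = Σ_i |x_i − y_i|` — the contour has `|x − y|₁` letters (`axial_length`), each `±δ` (`mem_axial`); transporting the contour of the
universal indicator form `U κ z := [· = (κ, z)]` along the evaluation homomorphisms (`axial_map`) reads all indicators off ONE contour, and each of its letters has
finset-ℓ¹ seminorm `≤ 1`.  No injectivity of the comb is used. -/
theorem sum_abs_axial_bondInd_sum_le (S : Finset (Fin n × (Fin n → ℤ))) (y x : Fin n → ℤ) :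
    ∑ b ∈ S, |(axial (bondInd b.1 b.2) y x).sum| ≤ ((∑ i : Fin n, (x i - y i).natAbs : ℕ) : ℤ) := by
  -- the universal indicator form with values in the lattice functions on bonds
  set U : Form1 n (Fin n × (Fin n → ℤ) → ℤ) := fun κ z b => if b = (κ, z) then 1 else 0 with hU
  have hb : ∀ b : Fin n × (Fin n → ℤ),
      bondInd b.1 b.2 = fun κ z => (Pi.evalAddMonoidHom (fun _ : Fin n × (Fin n → ℤ) => ℤ) b) (U κ z) := by
    intro b
    funext κ z
    rw [Pi.evalAddMonoidHom_apply, hU, bondInd_apply]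
    simp only [Prod.ext_iff]
    by_cases h1 : κ = b.1 <;> by_cases h2 : z = b.2 <;> simp [h1, h2, eq_comm]
  have hsum : ∀ b : Fin n × (Fin n → ℤ), (axial (bondInd b.1 b.2) y x).sum = (axial U y x).sum b := by
    intro b
    rw [hb b, axial_map, ← map_list_sum, Pi.evalAddMonoidHom_apply]
  simp only [hsum]
  -- every letter of the universal contour is `±U κ z`, of finset-ℓ¹ seminorm `≤ 1`
  have hU1 : ∀ (κ : Fin n) (z : Fin n → ℤ), ∑ b ∈ S, |U κ z b| ≤ 1 := by
    intro κ z
    have e : ∀ b ∈ S, |U κ z b| = if b = (κ, z) then (1 : ℤ) else 0 := by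
      intro b _; by_cases h : b = (κ, z) <;> simp [hU, h]
    rw [Finset.sum_congr rfl e]
    by_cases h : (κ, z) ∈ S
    · rw [Finset.sum_ite_eq' S (κ, z), if_pos h]
    · rw [Finset.sum_ite_eq' S (κ, z), if_neg h]; exact zero_le_one
  have hletters : ∀ a ∈ axial U y x, ∑ b ∈ S, |a b| ≤ 1 := by
    intro a ha
    obtain ⟨κ, z, e | e⟩ := mem_axial ha
    · rw [e]; exact hU1 κ z
    · rw [e]; simp only [Pi.neg_apply, abs_neg]; exact hU1 κ z
  have h := sum_abs_apply_list_sum_le S (axial U y x) hletters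
  rwa [axial_length] at h

/-- [folklore] **… HENCE FOR THE ROOTED TREE GAUGE FROM AN IN-BLOCK ROOT**: `Σ_{b ∈ S} |treeGaugeAt (toSite r) (bondInd b.1 b.2) N z| ≤ n·N` for every finite set `S` of
bonds (the contour from the root of `z`'s block has at most `n·N` bonds, `axial_length_le_of_root`) — the ℓ¹-dual of `AxialDressingRooted.abs_treeGaugeAt_bondInd_le`. -/
theorem sum_abs_treeGaugeAt_bondInd_le {N : ℕ} (hN : 1 ≤ N) {r : Fin n → ℕ} (hr : r ∈ box n N) (S : Finset (Fin n × (Fin n → ℤ)))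
    (z : Fin n → ℤ) : ∑ b ∈ S, |treeGaugeAt (toSite r) (bondInd b.1 b.2) N z| ≤ (n : ℤ) * N := by
  unfold treeGaugeAt
  refine (sum_abs_axial_bondInd_sum_le S _ z).trans ?_
  have h := axial_length_le_of_root hN hr (R := ℤ) (fun _ _ => (0 : ℤ)) z
  rw [axial_length] at h
  exact_mod_cast h

end Comb

/-! ## §2 The symmetrised tree gauge: `n!` combs in permuted coordinates -/

section Sym

variable {n : ℕ}

/-- [folklore] **THE ℓ¹-DUAL, SYMMETRISED**: for every finite set `S` of bonds and an in-block root, `Σ_{b ∈ S} |symTreeGaugeAt (toSite r) (bondIndR b.1 b.2) N x| ≤ n!·(n·N)`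
— the bound `SymmetrisedDressingMatrix.abs_symTreeGaugeAt_bondIndR_le` gives for ONE bond, now for the SUM over all bonds of `S` (`symTreeGaugeAt_eq_sum`: per axis
order `σ` the indicators pull back to the indicators of the `σ`-pulled-back bonds, `P1_bondIndR`, an injective re-indexing of `S`; then §1). -/
theorem sum_abs_symTreeGaugeAt_bondIndR_le {N : ℕ} (hN : 1 ≤ N) {r : Fin n → ℕ} (hr : r ∈ box n N)
    (S : Finset (Fin n × (Fin n → ℤ))) (x : Fin n → ℤ) :
    ∑ b ∈ S, |symTreeGaugeAt (toSite r) (bondIndR b.1 b.2) N x| ≤ (n ! : ℝ) * ((n : ℝ) * N) := by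
  -- per axis order: re-index the bonds and apply §1
  have hσ : ∀ σ : Equiv.Perm (Fin n),
      ∑ b ∈ S, |treeGaugeAt ((psite σ).symm (toSite r)) (P1 σ (bondIndR b.1 b.2)) N ((psite σ).symm x)| ≤ (n : ℝ) * N := by
    intro σ
    set e : (Fin n × (Fin n → ℤ)) ↪ (Fin n × (Fin n → ℤ)) :=
      (Equiv.prodCongr σ.symm (psite (β := ℤ) σ).symm).toEmbedding with he
    have hre : ∑ b ∈ S, |treeGaugeAt ((psite σ).symm (toSite r)) (P1 σ (bondIndR b.1 b.2)) N ((psite σ).symm x)|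
        = ((∑ b' ∈ S.map e, |treeGaugeAt (toSite ((psite σ).symm r)) (bondInd b'.1 b'.2) N ((psite σ).symm x)| : ℤ) : ℝ) := by
      rw [Int.cast_sum, Finset.sum_map]
      refine Finset.sum_congr rfl fun b _ => ?_
      rw [P1_bondIndR, psite_symm_toSite, treeGaugeAt_bondIndR, Int.cast_abs]
      rfl
    rw [hre]
    have h := sum_abs_treeGaugeAt_bondInd_le hN (psite_symm_mem_box σ hr) (S.map e) ((psite σ).symm x)
    exact_mod_cast h
  calc ∑ b ∈ S, |symTreeGaugeAt (toSite r) (bondIndR b.1 b.2) N x|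
      = ∑ b ∈ S, |∑ σ : Equiv.Perm (Fin n),
          treeGaugeAt ((psite σ).symm (toSite r)) (P1 σ (bondIndR b.1 b.2)) N ((psite σ).symm x)| :=
        Finset.sum_congr rfl fun b _ => by rw [symTreeGaugeAt_eq_sum]
    _ ≤ ∑ b ∈ S, ∑ σ : Equiv.Perm (Fin n),
          |treeGaugeAt ((psite σ).symm (toSite r)) (P1 σ (bondIndR b.1 b.2)) N ((psite σ).symm x)| :=
        Finset.sum_le_sum fun b _ => Finset.abs_sum_le_sum_abs _ _
    _ = ∑ σ : Equiv.Perm (Fin n), ∑ b ∈ S,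
          |treeGaugeAt ((psite σ).symm (toSite r)) (P1 σ (bondIndR b.1 b.2)) N ((psite σ).symm x)| := Finset.sum_comm
    _ ≤ ∑ _σ : Equiv.Perm (Fin n), (n : ℝ) * N := Finset.sum_le_sum fun σ _ => hσ σ
    _ = (n ! : ℝ) * ((n : ℝ) * N) := by
        rw [Finset.sum_const, Finset.card_univ, card_perm_fin, nsmul_eq_mul]

end Sym

/-! ## §3 an1's comb weights `lam04` (centred root, `d+1` directions): the block-ℓ¹ law, POWER `N¹` after `|box|⁻¹` -/

section Lam

variable {d : ℕ}

/-- [folklore] `toSite` is injective, hence so is `b ↦ (κ, N•y′ + toSite b)` jointly in `(κ, b)`. -/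
theorem slot_injective (N : ℕ) (y' : Fin (d + 1) → ℤ) :
    Function.Injective fun p : Fin (d + 1) × (Fin (d + 1) → ℕ) => (p.1, (N : ℤ) • y' + toSite p.2) := by
  intro p q h
  simp only [Prod.mk.injEq, add_right_inj] at h
  refine Prod.ext h.1 (funext fun i => ?_)
  have hi := congrFun h.2 i
  simp only [toSite, Nat.cast_inj] at hi
  exact hi

/-- [folklore] **THE BLOCK-ℓ¹ LAW OF an1's COMB WEIGHTS, ALL DIRECTIONS**: for every coarse block `y′` and every coarse point `Y`,
`Σ_κ Σ_{b ∈ box (d+1) N} |lam04 N κ (N•y′ + b) Y| ≤ N^{d+1}·((d+1)·N)` — the SAME bound the tree has for a single bond (`DshAn1Spread.abs_lam04_le`), now for the sum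
over all `(d+1)·N^{d+1}` bonds based in the block (`SymLamAt_eq_sum_symTreeGaugeAt`: `N^{d+1}` targets, each contributing `≤ (d+1)!·((d+1)·N)` by §2, weight
`((d+1)!)⁻¹`).  After the face weights' normalisation `|box|⁻¹ = N^{−(d+1)}`: `≤ (d+1)·N`, POWER `N¹` (N-g22-1's count: `≈ (D∕4)·N`). -/
theorem sum_univ_box_abs_lam04_le {N : ℕ} (hN : 1 ≤ N) (y' Y : Fin (d + 1) → ℤ) :
    ∑ κ : Fin (d + 1), ∑ b ∈ box (d + 1) N, |lam04 N κ ((N : ℤ) • y' + toSite b) Y| ≤ (N : ℝ) ^ (d + 1) * (((d : ℝ) + 1) * N) := by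
  have hf : (0 : ℝ) < ((d + 1) ! : ℝ) := by exact_mod_cast Nat.factorial_pos _
  -- the finite set of all bonds based in the block `y′`
  set e : (Fin (d + 1) × (Fin (d + 1) → ℕ)) ↪ (Fin (d + 1) × (Fin (d + 1) → ℤ)) := ⟨_, slot_injective N y'⟩ with he
  set S : Finset (Fin (d + 1) × (Fin (d + 1) → ℤ)) := ((Finset.univ : Finset (Fin (d + 1))) ×ˢ box (d + 1) N).map e with hS
  -- per target point of the block `Y`: §2 on `S`
  have htarget : ∀ b' ∈ box (d + 1) N,
      ∑ κ : Fin (d + 1), ∑ b ∈ box (d + 1) N,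
        |symTreeGaugeAt (ctr (d + 1) N) (delta1 κ ((N : ℤ) • y' + toSite b)) N ((N : ℤ) • Y + toSite b')|
        ≤ ((d + 1) ! : ℝ) * (((d : ℝ) + 1) * N) := by
    intro b' _
    have h := sum_abs_symTreeGaugeAt_bondIndR_le hN (ctrOff_mem_box hN) S ((N : ℤ) • Y + toSite b')
    rw [hS, Finset.sum_map, Finset.sum_product] at h
    have e4 : (((d + 1 : ℕ) : ℕ) : ℝ) = (d : ℝ) + 1 := by push_cast; ring
    rw [e4] at h
    refine le_of_eq_of_le (Finset.sum_congr rfl fun κ _ => Finset.sum_congr rfl fun b _ => ?_) h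
    rw [← bondIndR_eq_delta1]
    rfl
  -- unfold `lam04` and the block sum of `SymLamAt`
  have hpt : ∀ (κ : Fin (d + 1)) (b : Fin (d + 1) → ℕ), |lam04 N κ ((N : ℤ) • y' + toSite b) Y|
      ≤ ((d + 1) ! : ℝ)⁻¹ * ∑ b' ∈ box (d + 1) N,
        |symTreeGaugeAt (ctr (d + 1) N) (delta1 κ ((N : ℤ) • y' + toSite b)) N ((N : ℤ) • Y + toSite b')| := by
    intro κ b
    rw [lam04, SymLamAt_eq_sum_symTreeGaugeAt, abs_mul, abs_inv, Nat.abs_cast]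
    exact mul_le_mul_of_nonneg_left (Finset.abs_sum_le_sum_abs _ _) (inv_nonneg.2 hf.le)
  calc ∑ κ : Fin (d + 1), ∑ b ∈ box (d + 1) N, |lam04 N κ ((N : ℤ) • y' + toSite b) Y|
      ≤ ∑ κ : Fin (d + 1), ∑ b ∈ box (d + 1) N, ((d + 1) ! : ℝ)⁻¹ * ∑ b' ∈ box (d + 1) N,
          |symTreeGaugeAt (ctr (d + 1) N) (delta1 κ ((N : ℤ) • y' + toSite b)) N ((N : ℤ) • Y + toSite b')| :=
        Finset.sum_le_sum fun κ _ => Finset.sum_le_sum fun b _ => hpt κ b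
    _ = ((d + 1) ! : ℝ)⁻¹ * ∑ b' ∈ box (d + 1) N, ∑ κ : Fin (d + 1), ∑ b ∈ box (d + 1) N,
          |symTreeGaugeAt (ctr (d + 1) N) (delta1 κ ((N : ℤ) • y' + toSite b)) N ((N : ℤ) • Y + toSite b')| := by
        have hswap : ∀ κ : Fin (d + 1), ∑ b ∈ box (d + 1) N, ((d + 1) ! : ℝ)⁻¹ * ∑ b' ∈ box (d + 1) N,
            |symTreeGaugeAt (ctr (d + 1) N) (delta1 κ ((N : ℤ) • y' + toSite b)) N ((N : ℤ) • Y + toSite b')|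
            = ∑ b' ∈ box (d + 1) N, ∑ b ∈ box (d + 1) N, ((d + 1) ! : ℝ)⁻¹ *
              |symTreeGaugeAt (ctr (d + 1) N) (delta1 κ ((N : ℤ) • y' + toSite b)) N ((N : ℤ) • Y + toSite b')| := by
          intro κ
          rw [Finset.sum_comm]
          exact Finset.sum_congr rfl fun b _ => Finset.mul_sum _ _ _
        rw [Finset.sum_congr rfl fun κ _ => hswap κ, Finset.sum_comm, Finset.mul_sum]
        refine Finset.sum_congr rfl fun b' _ => ?_
        rw [Finset.mul_sum]
        refine Finset.sum_congr rfl fun κ _ => ?_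
        rw [Finset.mul_sum]
    _ ≤ ((d + 1) ! : ℝ)⁻¹ * ∑ _b' ∈ box (d + 1) N, ((d + 1) ! : ℝ) * (((d : ℝ) + 1) * N) :=
        mul_le_mul_of_nonneg_left (Finset.sum_le_sum htarget) (inv_nonneg.2 hf.le)
    _ = (N : ℝ) ^ (d + 1) * (((d : ℝ) + 1) * N) := by
        have hcard : (box (d + 1) N).card = N ^ (d + 1) := by simp [AffineAveraging.box, Fintype.card_piFinset]
        rw [Finset.sum_const, hcard, nsmul_eq_mul]
        push_cast
        field_simp

/-- [folklore] **THE BLOCK-ℓ¹ LAW, ONE DIRECTION**: `Σ_{b ∈ box (d+1) N} |lam04 N κ (N•y′ + b) Y| ≤ N^{d+1}·((d+1)·N)`. -/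
theorem sum_box_abs_lam04_le {N : ℕ} (hN : 1 ≤ N) (κ : Fin (d + 1)) (y' Y : Fin (d + 1) → ℤ) :
    ∑ b ∈ box (d + 1) N, |lam04 N κ ((N : ℤ) • y' + toSite b) Y| ≤ (N : ℝ) ^ (d + 1) * (((d : ℝ) + 1) * N) := by
  refine le_trans ?_ (sum_univ_box_abs_lam04_le hN y' Y)
  exact Finset.single_le_sum (f := fun κ' => ∑ b ∈ box (d + 1) N, |lam04 N κ' ((N : ℤ) • y' + toSite b) Y|)
    (fun κ' _ => Finset.sum_nonneg fun b _ => abs_nonneg _) (Finset.mem_univ κ)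

/-- [folklore] **THE FACE WEIGHTS' BLOCK-ℓ¹ LAW** — «FACE-PACK»'s `hcB` with `cW := d+1`: the weights `c κ u := |box (d+1) N|⁻¹·lam04 N κ u (blk N u)` of the OWNER's face family
(`J1-DEFECT-WORDS` v0.1 (ii): `c_{α,x} = |box|⁻¹·ζ_S(e_{(α,x)})(blk x)`) satisfy `Σ_{b ∈ box (d+1) N} |c κ (N•y′ + b)| ≤ N·(d+1)` for every direction `κ` and coarse block `y′`
(`blk N (N•y′ + b) = y′`, `|box| = N^{d+1}`, previous lemma; stated as `N·cW`, the binder shape of «FACE-PACK»'s `hcB`). -/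
theorem sum_box_abs_faceWeight_le {N : ℕ} (hN : 1 ≤ N) (κ : Fin (d + 1)) (y' : Fin (d + 1) → ℤ) :
    ∑ b ∈ box (d + 1) N, |((box (d + 1) N).card : ℝ)⁻¹ * lam04 N κ ((N : ℤ) • y' + toSite b) (blk N ((N : ℤ) • y' + toSite b))|
      ≤ (N : ℝ) * ((d : ℝ) + 1) := by
  have hN0 : (0 : ℝ) < (N : ℝ) := by exact_mod_cast hN
  have hNp : (0 : ℝ) < (N : ℝ) ^ (d + 1) := pow_pos hN0 _
  have hterm : ∀ b ∈ box (d + 1) N,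
      |((box (d + 1) N).card : ℝ)⁻¹ * lam04 N κ ((N : ℤ) • y' + toSite b) (blk N ((N : ℤ) • y' + toSite b))|
        = ((N : ℝ) ^ (d + 1))⁻¹ * |lam04 N κ ((N : ℤ) • y' + toSite b) y'| := by
    intro b hb
    have hcard : (box (d + 1) N).card = N ^ (d + 1) := by simp [AffineAveraging.box, Fintype.card_piFinset]
    rw [blk_block y' hb, hcard, abs_mul, abs_inv]
    push_cast
    rw [abs_of_pos hNp]
  rw [Finset.sum_congr rfl hterm, ← Finset.mul_sum]
  calc ((N : ℝ) ^ (d + 1))⁻¹ * ∑ b ∈ box (d + 1) N, |lam04 N κ ((N : ℤ) • y' + toSite b) y'|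
      ≤ ((N : ℝ) ^ (d + 1))⁻¹ * ((N : ℝ) ^ (d + 1) * (((d : ℝ) + 1) * N)) :=
        mul_le_mul_of_nonneg_left (sum_box_abs_lam04_le hN κ y' y') (inv_nonneg.2 hNp.le)
    _ = (N : ℝ) * ((d : ℝ) + 1) := by field_simp

/-- [folklore] **THE SAME LAW IN leaf-03's LETTER `zetaS`** (`SymCorrectorForms.zetaS ρ_c N (delta1 κ u) = lam04 N κ u` DEFINITIONALLY, root `toSite (ctrOff (d+1) N) = ctr (d+1) N`):
the TT3a face weight `faceWt (ctrOff (d+1) N) N κ u = |box|⁻¹·zetaS (toSite (ctrOff (d+1) N)) N (indR κ u) (blk N u)` (`indR_eq_delta1` away) has block-ℓ¹ norm `≤ N·(d+1)`. -/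
theorem sum_box_abs_zetaS_delta1_le {N : ℕ} (hN : 1 ≤ N) (κ : Fin (d + 1)) (y' : Fin (d + 1) → ℤ) :
    ∑ b ∈ box (d + 1) N, |((box (d + 1) N).card : ℝ)⁻¹
        * zetaS (toSite (ctrOff (d + 1) N)) N (delta1 κ ((N : ℤ) • y' + toSite b)) (blk N ((N : ℤ) • y' + toSite b))|
      ≤ (N : ℝ) * ((d : ℝ) + 1) :=
  sum_box_abs_faceWeight_le hN κ y'

end Lam

end Summit.QuantumFields.BalabanUV.Beta.BondIndicatorGaugeL1

end
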